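import Summits.QuantumFields.YangMills.Theorems.BalabanUVNodesSpineReadingOfRecord13CoPH

/-!
# BalabanUVNodes ∕ N20 (NE7b) — LOCATED, KERNEL FORM: AT THE ZERO CUT THE N20 FACE OF THE SPINE READING OF RECORD IS FREE.  `badKeysSigma F T (fun _ ↦ 0) = ∅`, so
# `RelWeightBound` holds at `crOfRecord₁₃At K₀ (fun _ ↦ 0) sh` for EVERY tuple with the ZERO weight (and hence with the reading's canonical `wInf`), no estimate used; the
# `KeyedRelWeight cr` conjunct of the registered K3⁷ v2 stub 2 («`∃ (jcut : ℕ → ℕ) sh cr, PinnedAtLive jcut sh cr ∧ KeyedRelWeight cr ∧ …`») is discharged by the witness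
# `jcut := fun _ ↦ 0` ALONE — at that witness the good class is ALL of `classSet₁₃` and the cut's content sits entirely in `KeyedCoreEdgeHolderD4` ∕ `KeyedShellWeight`

Cell `pub-ymgap` (HUMAN RULING D-0062 Track A; work-bound push D-0149, director-ym №197), width seat `pub-ymgap-dag-n20-w2` (gen 0) on node N20 = NE7b; a LOCATED companion to
modules 1–4 of plan g77 `W-SEAT-START-LIST.md` §2 n20 ITEM 2, written the hour dag-n20-d's spine reading of record `crOfRecord₁₃` (`Thm/BalabanUVNodesSpineReadingOfRecord13CoPH`,
p587226; `Bad := badKeysSigma F (classSet₁₃ …) jcut`, plan g79 WORDS-1 (A) Q3 «`jcut` displayed and UNPINNED») and the K3⁷ v2 skeleton (plan g79, 145a664ea9c38a7b, stub 2 under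
`∃ jcut sh cr`) became of record.  Filed `--kind proof --supports stmt-QuantumFields-20544 --as helper` (K3⁷ `SpineGivenEndpointR13SepCoPH`); COUNT-NEUTRAL; LOCATED (it decides
no count and proves no estimate — it says what the typed stub lets a prover choose).  [LF-II] = [Balaban1989LargeFieldII].

WHY.  dag-n20-w3's LOCATED-1 (pub-ymgap INBOX 2026-08-27) and plan g78 WORDS-2 (β) read: «if reading (i) prevails, the h20 face at `crOfRecord₁₃` becomes honest-trivial
(`relWeightBound_of_bad_empty`) and the core-edge face carries NE7 on all histories».  With `jcut` UNPINNED under `∃`, reading (i) is not a ruling to wait for — it is a WITNESS the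
stub already admits.  This file types that witness at the reading of record, BY NAME over dag-n20-d's dictionary:
* §1 `badKeysSigma_policy_zero` (`Node00.not_keyOldLargeField_zero`) · `badClass₁₃_cutZero`;
* §2 ★ `relWeightBound_carriers₁₃_cutZero` (`RelWeightBound 1 (classSet₁₃ …) (weightA₁₃ …) (weightB₁₃ …) (badClass₁₃ … (fun _ ↦ 0)) (fun _ ↦ 0)` — both bad sums are empty) ·
  ★★ `relWeightBound_crOfRecord₁₃At_cutZero` (dag-n20-d's `relWeightBound_crOfRecord₁₃At` transfers it to the canonical `W`) · ★★ `keyedRelWeight_shape_crOfRecord₁₃_cutZero` (the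
  skeleton's `KeyedRelWeight (crOfRecord₁₃ (fun _ ↦ 0) sh)` body VERBATIM at `N = 2`, every guarded admissible tuple — the guards unused);
* §3 `classSet₁₃_sdiff_badClass₁₃_cutZero` (the good class at that witness is the whole class set: `hedge` then compares the runs on EVERY keyed class).
WHAT FOLLOWS FOR THE SKELETON (for plan ∕ the disprover, not decided here): as registered, stub 2's N20 conjunct is closable at no cost and N20 = NE7b is NOT a separate obligation of
K3⁷ v2 — the `∃ jcut` makes the cut a free trade-off between `KeyedRelWeight` (easier as `jcut ↓`, free at `0`) and `KeyedCoreEdgeHolderD4` (easier as `jcut ↑`, dag-n20-w3's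
`core_badKeysSigma_of_policy_le` ∕ `relWeightBound_badKeysSigma_of_policy_le`).  If N20 is MEANT to carry content at this index, the stub needs a guard on the policy (e.g. the
window policy `jcut K = K₀ + K − j⋆(K)` with `1 ≤ jcut K`, or a joint nondegeneracy clause); if reading (i) is intended, this file IS the N20 conjunct's proof at the zero cut.
Cited BY NAME, not re-typed: dag-n20-d `…SpineReadingOfRecord13CoPH` (`classSet₁₃`, `weightA₁₃`, `weightB₁₃`, `badClass₁₃`, `badClass₁₃_subset`, `crOfRecord₁₃At`, `crOfRecord₁₃`,
`relWeightBound_crOfRecord₁₃At`), `…SpineCanonicalWeights` (`wInf`, via the transfer), `Node00/TwoRunSitePersistence` (`badKeysSigma`, `mem_badKeysSigma_iff`,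
`not_keyOldLargeField_zero`).

HONEST FRAMING.  Bookkeeping; NO estimate; a located reading of the registered stub text, count-neutral.  It does NOT say NE7b is false or vacuous as mathematics — it says the
(2.18)-index persistence class with an unpinned cut does not encode it (dag-n20-w3 LOCATED-1: «created», not «old AND pending»; reading (ii) = an index carrying 𝐑-status, a
design question for node00-def-RR-2).  Nothing of Bałaban's is asserted; NE7 ∕ NE7b ∕ NE7c NOT PRINTED for `d = 4`, NOT proved; N19 ∕ N20 ∕ N21 ∕ N27 NOT discharged; K3⁷ NOT
closed (stub 2's other three conjuncts and stub 1 are untouched); counts unmoved (typed 28∕28 · discharged 5∕27); no count claim.  One finite `𝕋⁴_{L^K}` programme at fixed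
`ε = L^{−K}`, Bałaban AS PRINTED; the YM mass gap (Clay) is NOT proved by any of this — R4 closes the conditional finite-𝕋⁴ rung `BalabanLadder.UV` only; NOT ℝ⁴, NOT OS.
No `def`, no `instance`, no `notation`, no `sorry`.  Sources (bookkeeping): [LF-II] Thm 1 + (0.1) pp.355–356, (1.80) p.384; [King1986] (3.10) p.656.
-/

noncomputable section

open scoped BigOperators

namespace Summit.QuantumFields.YangMills.BalabanUVNodes.N20KeyedRelWeightCutZero

open Literature.MathematicalPhysics.QuantumFieldTheory.Balaban1983to89 Literature.MathematicalPhysics.QuantumFieldTheory.Balaban1983to89.Node00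
open T4Continuum
open T4WeightBudget (RelWeightBound)
open YMDAG.UVSplit

variable (F : T4Family) {N : ℕ} [NeZero N]

/-! ## §1  At cut level `0` the persistence class is EMPTY -/

/-- **THE σ-PACKED PERSISTENCE CLASS AT THE ZERO POLICY IS EMPTY**: `badKeysSigma F T (fun _ ↦ 0) = ∅` — no key has an old large-field region below level `0`
(`Node00.not_keyOldLargeField_zero`). [cite: Balaban1989LargeFieldII, (1.80) p.384 (bookkeeping)] -/
theorem badKeysSigma_policy_zero {K₀ : ℕ} (T : Finset (Σ K, SiteSeqKey F (K₀ + K))) : badKeysSigma F T (fun _ => 0) = ∅ :=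
  Finset.eq_empty_of_forall_notMem fun x hx => not_keyOldLargeField_zero x.2 ((mem_badKeysSigma_iff F T _ x).1 hx).2

/-- … hence the bad class of the spine reading of record at the zero cut is empty at every step and source. [cite: King1986, (3.10) p.656 (bookkeeping)] -/
theorem badClass₁₃_cutZero (θ : Stage13HParams F N) (K₀ : ℕ) (g₀ : ℕ → ℝ) (K : ℕ) (t : ℝ) : badClass₁₃ θ K₀ g₀ (fun _ => 0) K t = ∅ :=
  badKeysSigma_policy_zero F _

/-! ## §2  The N20 face at the zero cut holds OUTRIGHT — with the zero weight -/

/-- **`RelWeightBound` AT THE READING's CARRIERS WITH THE ZERO CUT AND THE ZERO WEIGHT**: with `Bad = ∅` both bad sums vanish, so `W := 0` is an admissible relative weight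
(`0 ≤ 0 < 1`, summable) — for EVERY tuple, datum, `g₀`, `os`, WITHOUT any estimate.  This is the kernel form of reading (i) of dag-n20-w3's LOCATED-1 ∕ plan g78 WORDS-2 (β):
at the (2.18) index the N20 face is honest-trivial once the cut is `0`. [cite: King1986, (3.10) p.656; Balaban1989LargeFieldII, (1.80) p.384 (bookkeeping)] -/
theorem relWeightBound_carriers₁₃_cutZero (θ : Stage13HParams F N) (hP : θ.Provisos₁₃CoPH F N) (K₀ : ℕ) (g₀ : ℕ → ℝ) (os : List (ULoop F)) :
    RelWeightBound 1 (classSet₁₃ θ K₀ g₀) (weightA₁₃ θ hP K₀ g₀ os) (weightB₁₃ θ hP K₀ g₀ os) (badClass₁₃ θ K₀ g₀ (fun _ => 0)) (fun _ => 0) where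
  bad_subset K t _ := badClass₁₃_subset θ K₀ g₀ _ K t
  nonneg _ := le_rfl
  lt_one _ := zero_lt_one
  summable := summable_zero
  bad_left K t _ := by rw [badClass₁₃_cutZero, Finset.sum_empty, zero_mul]
  bad_right K t _ := by rw [badClass₁₃_cutZero, Finset.sum_empty, zero_mul]

/-- **★★ THE N20 FACE OF K3⁷ v2 STUB 2 AT `crOfRecord₁₃At K₀ (fun _ ↦ 0) sh` HOLDS FOR EVERY TUPLE, UNCONDITIONALLY** (the reading's canonical `W = wInf …` inherits the zero
witness by dag-n20-d's `relWeightBound_crOfRecord₁₃At`).  CONSEQUENCE (located, count-neutral): under the registered stub text «`∃ (jcut : ℕ → ℕ) (sh) (cr), PinnedAtLive jcut sh cr ∧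
KeyedRelWeight cr ∧ …`» the conjunct `KeyedRelWeight cr` books NOTHING by itself — the witness `jcut := fun _ ↦ 0`, `cr := crOfRecord₁₃ (fun _ ↦ 0) sh` discharges it here — and the
cut's content sits entirely in the JOINT choice with `KeyedCoreEdgeHolderD4` (whose good class is then ALL of `classSet₁₃`, dag-n20-w3's `core_badKeysSigma_of_policy_le` trade-off)
and `KeyedShellWeight`. [cite: King1986, (3.10) p.656; Balaban1989LargeFieldII, Thm 1 + (0.1) pp.355–356, (1.80) p.384 (bookkeeping)] -/
theorem relWeightBound_crOfRecord₁₃At_cutZero (K₀ : ℕ) (sh : ShellSplit₁₃CoPH N K₀) (θ : Stage13HParams F N) (hP : θ.Provisos₁₃CoPH F N) (g₀ : ℕ → ℝ)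
    (os : List (ULoop F)) :
    RelWeightBound (crOfRecord₁₃At K₀ (fun _ => 0) sh F θ hP g₀ os).l₀ (crOfRecord₁₃At K₀ (fun _ => 0) sh F θ hP g₀ os).T
      (crOfRecord₁₃At K₀ (fun _ => 0) sh F θ hP g₀ os).A (crOfRecord₁₃At K₀ (fun _ => 0) sh F θ hP g₀ os).B
      (crOfRecord₁₃At K₀ (fun _ => 0) sh F θ hP g₀ os).Bad (crOfRecord₁₃At K₀ (fun _ => 0) sh F θ hP g₀ os).W :=
  relWeightBound_crOfRecord₁₃At K₀ _ sh θ hP g₀ os (relWeightBound_carriers₁₃_cutZero F θ hP K₀ g₀ os)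

/-- **★★ THE `KeyedRelWeight` BINDER SHAPE OF THE REGISTERED K3⁷ v2 SKELETON AT `crOfRecord₁₃ (fun _ ↦ 0) sh`, SPELLED OUT** (`N = 2`, every guarded admissible Stage-13 tuple
with core provisos, every `g₀`, `os` — the guards are not even used): the N20 conjunct of `stub_expansion13H` at the zero cut.  A skeleton composer obtains `KeyedRelWeight
(crOfRecord₁₃ (fun _ ↦ 0) sh)` from this by `fun F θ hP _ _ g₀ os => …` (the `def` is the skeleton's, not the tree's). [cite: King1986, (3.10) p.656; Balaban1989LargeFieldII, Thm 1 + (0.1) pp.355–356 (bookkeeping)] -/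
theorem keyedRelWeight_shape_crOfRecord₁₃_cutZero (sh : ShellSplit₁₃CoPH 2 0) :
    ∀ (F : T4Family) (θ : Stage13HParams F 2) (hP : θ.Provisos₁₃CoPH F 2), (θ.ZhUnity F 2 ∧ θ.SlotsNondegenerate₁₃ F 2) → θ.Admissible F 2 →
      ∀ (g₀ : ℕ → ℝ) (os : List (ULoop F)),
        RelWeightBound (crOfRecord₁₃ (fun _ => 0) sh F θ hP g₀ os).l₀ (crOfRecord₁₃ (fun _ => 0) sh F θ hP g₀ os).T
          (crOfRecord₁₃ (fun _ => 0) sh F θ hP g₀ os).A (crOfRecord₁₃ (fun _ => 0) sh F θ hP g₀ os).B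
          (crOfRecord₁₃ (fun _ => 0) sh F θ hP g₀ os).Bad (crOfRecord₁₃ (fun _ => 0) sh F θ hP g₀ os).W :=
  fun F θ hP _ _ g₀ os => relWeightBound_crOfRecord₁₃At_cutZero F 0 sh θ hP g₀ os

/-! ## §3  … and at the zero cut the GOOD class is EVERYTHING: what the core edge then has to carry -/

/-- **AT THE ZERO CUT THE GOOD CLASS OF THE READING IS THE WHOLE CLASS SET** (`classSet₁₃ ∖ ∅`): the `hedge` ∕ `KeyedCoreEdgeHolderD4` face at the same witness compares the two
runs on EVERY keyed class — NE7 proper on all large-field histories (reading (i)). [cite: King1986, (3.10) p.656 (bookkeeping)] -/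
theorem classSet₁₃_sdiff_badClass₁₃_cutZero [DecidableEq ((K : ℕ) × SiteSeqKey F (0 + K))] (θ : Stage13HParams F N) (g₀ : ℕ → ℝ) (K : ℕ) (t : ℝ) :
    classSet₁₃ θ 0 g₀ K \ badClass₁₃ θ 0 g₀ (fun _ => 0) K t = classSet₁₃ θ 0 g₀ K := by
  rw [badClass₁₃_cutZero, Finset.sdiff_empty]

end Summit.QuantumFields.YangMills.BalabanUVNodes.N20KeyedRelWeightCutZero

end
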